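import Literature.NumberTheory.NumberFields.CubicFieldDedekindKummer
import Mathlib.NumberTheory.NumberField.ClassNumber
import Mathlib.NumberTheory.NumberField.Discriminant.Basic
import Mathlib.Analysis.Real.Pi.Bounds
import Mathlib.Tactic.ComputeDegree
import Mathlib.Tactic.NormNum.Prime
import HarnessLib

/-!
# The cubic field of discriminant `−307`: `F = ℚ(θ)`, `θ³ − θ² + 3θ + 2 = 0` — `𝓞_F = ℤ[θ]`, `d_F = −307`,
# signature `(1, 1)`, the primes above `2` and `3`, and CLASS NUMBER ONE (LMFDB number field 3.1.307.1) — PROVED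

Topic `Literature/NumberTheory/CubicFields`, namespace `Literature.NumberTheory.CubicFields.CubicDisc307` (the object: the
cubic field of discriminant `−307`; companion of `CubicFieldDiscriminantTwentyThree*.lean` / `…ThirtyOne*.lean`).
THEOREMS ONLY (no definition, no named fact, no instance, no notation); every statement is PROVED.  Written by the prover
seat `bsd-line-att-p4` g27 (cell `bsd-f1-sign2`) to discharge, in the kernel, the one displayed datum `2 ∤ h(ℚ(β))` of the
`307b1` row of crux C2 of route `AlignedTransportAtTwo` (`ℚ(β)`, `4β³ + 5β² − 4 = 0`, IS this field: `θ = β² − ¾β − ½`).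

## Source

[LMFDB] The L-functions and Modular Forms Database, number field `3.1.307.1`: defining polynomial `x³ − x² + 3x + 2`,
degree `3`, signature `[1, 1]`, discriminant `−307`, ring of integers `ℤ[a]`, **class number `1`** (table entries).
D. A. Marcus, *Number Fields*, 2nd ed. (2018) [Marcus2018], Ch. 2 Ex. 27 (index criterion), Ch. 3 Thm. 27 (Dedekind–Kummer),
Ch. 5 Thm. 37 and Cor. 2 (the class group is generated by the primes of norm at most the Minkowski bound).

## Carrier

`F` is ANY number field with `[F : ℚ] = 3` containing `α` with `α³ − α² + 3α + 2 = 0`, i.e. `aeval α f = 0` for the tree's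
`f = MonicCubic.poly (-1) 3 2 = X³ − X² + 3X + 2 ∈ ℤ[X]` (every model of the cubic field of discriminant `−307`; uniqueness of
that field — `h(ℚ(√−307)) = 3` — is not used).  `θ := MonicCubic.thetaInt hα ∈ 𝓞 F`.

## What is formalised (all PROVED)

* §1 the polynomial: `disc_eq` (`Δ(f) = −307`), `isUnit_of_disc_eq_sq_mul` (`307` is prime, so the square-factor condition of the
  tree's index criterion holds), `no_root_seven` / `irreducible_polyQ` (`f` has no root mod `7`, hence is irreducible over `ℚ`),
  `polyMod_two` (`f ≡ X(X² + X + 1) (mod 2)`), `polyMod_three` (`f ≡ (X + 1)(X² + X + 2) (mod 3)`), and the irreducibility of the two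
  quadratic factors.
* §2 the field: `discr_eq` (**`d_F = −307`**), `adjoin_thetaInt_eq_top` (**`𝓞_F = ℤ[θ]`**), `nrComplexPlaces_eq_one` /
  `nrRealPlaces_eq_one` (**signature `(1, 1)`**).
* §3 the four small primes are principal, by EXPLICIT GENERATORS (pure ideal arithmetic from `θ³ = θ² − 3θ − 2`):
  `(2, θ) = (θ)`, `(2, θ² + θ + 1) = (θ² − θ + 3)` (`θ·(θ² − θ + 3) = −2`), `(3, θ + 1) = (θ + 1)`,
  `(3, θ² + θ + 2) = (θ² − 2θ + 5)` (`(θ + 1)(θ² − 2θ + 5) = 3`); hence **every prime of `𝓞_F` above `2` or `3` is principal**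
  (`isPrincipal_of_mem_primesOver_two` / `_three`, Dedekind–Kummer through the tree's `MonicCubic.exists_factor_of_mem_primesOver`).
* §4 ★ **`h_F = 1`** (`isPrincipalIdealRing`, `classNumber_eq_one`): Minkowski's bound is `(4/π)(3!/3³)√307 < 5`, so by Mathlib's
  `RingOfIntegers.isPrincipalIdealRing_of_isPrincipal_of_pow_le_of_mem_primesOver_of_mem_Icc` it suffices that the primes above
  `2` and `3` be principal (§3).  Corollary `not_two_dvd_classNumber` (the form consumed downstream).

## Mathlib / tree search
Tree (consumed BY NAME): `MonicCubic.{poly, polyQ, polyMod, disc, thetaInt, thetaInt_rel, discr_eq_disc, adjoin_thetaInt_eq_top,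
exists_factor_of_mem_primesOver, irreducible_polyQ_of_no_root}` (`NumberFields/CubicField{Explicit,Integers,DedekindKummer}`); pattern of
`CubicFields.CubicDisc23` (signature, Minkowski) and `NumberFields.CyclicCubic1339A` (explicit generators).  Mathlib:
`RingOfIntegers.isPrincipalIdealRing_of_isPrincipal_of_pow_le_of_mem_primesOver_of_mem_Icc`, `NumberField.classNumber_eq_one_iff`,
`NumberField.sign_discr`, `Real.pi_gt_d2`, `Real.sqrt_lt'`, `Nat.floor_lt'`, `Polynomial.irreducible_of_degree_le_three_of_not_isRoot`.
`rg "307" lean/Literature/NumberTheory/{CubicFields,NumberFields}` → nothing: the invariants of this field are new in the tree.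

## References
* [LMFDB] The LMFDB Collaboration, The L-functions and Modular Forms Database, number field 3.1.307.1.
* [Marcus2018] D. A. Marcus, *Number Fields*, 2nd ed., Universitext, Springer 2018, Ch. 2 Ex. 27, Ch. 3 Thm. 27, Ch. 5 Thm. 37.
-/

noncomputable section

open Polynomial NumberField NumberField.InfinitePlace Ideal Module Real
open Literature.NumberTheory.NumberFields
open Literature.NumberTheory.NumberFields.MonicCubic

namespace Literature.NumberTheory.CubicFields.CubicDisc307

/-! ## §1 The polynomial `f = X³ − X² + 3X + 2` -/

/-- `Δ(X³ − X² + 3X + 2) = −307` (`a = −1, b = 3, c = 2`: `a²b² − 4b³ − 4a³c − 27c² + 18abc = 9 − 108 + 8 − 108 − 108`).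
[cite: LMFDB, number field 3.1.307.1 (discriminant −307)] -/
theorem disc_eq : disc (-1) 3 2 = -307 := by
  norm_num [disc]

/-- The square-factor condition of the tree's index criterion for `f`: `−307 = r²e` with `|e| > 2` forces `r = ±1`
(`307` is prime). [cite: Marcus2018, Ch. 2, Exercise 27] -/
theorem isUnit_of_disc_eq_sq_mul : ∀ r e : ℤ, disc (-1) 3 2 = r ^ 2 * e → 2 < |e| → IsUnit r := by
  intro r e h _
  rw [disc_eq] at h
  have hdvd : r.natAbs ^ 2 ∣ 307 := by
    have h1 : r ^ 2 ∣ (307 : ℤ) := ⟨-e, by linear_combination -h⟩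
    have h2 : ((r.natAbs ^ 2 : ℕ) : ℤ) ∣ (307 : ℕ) := by
      rw [Nat.cast_pow, Int.natCast_natAbs, sq_abs]; exact_mod_cast h1
    exact Int.natCast_dvd_natCast.mp h2
  rcases (Nat.dvd_prime (by norm_num : Nat.Prime 307)).mp hdvd with h1 | h307
  · rw [Int.isUnit_iff_natAbs_eq]
    exact (Nat.pow_eq_one.mp h1).resolve_right two_ne_zero
  · exfalso
    have hle : r.natAbs ≤ 18 := by nlinarith
    interval_cases hr : r.natAbs <;> omega

/-- `f` has no root modulo `7` (`f(0..6) ≡ 2, 5, 5, 1, 6, 5, 4`). [cite: Marcus2018, Ch. 3, Thm. 27] -/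
theorem no_root_seven :
    ∀ r : ZMod 7, r ^ 3 + ((-1 : ℤ) : ZMod 7) * r ^ 2 + ((3 : ℤ) : ZMod 7) * r + ((2 : ℤ) : ZMod 7) ≠ 0 := by
  decide

/-- **`f = X³ − X² + 3X + 2` is irreducible over `ℚ`** (no root modulo `7`; the tree's `irreducible_polyQ_of_no_root`).
[cite: LMFDB, number field 3.1.307.1 (defining polynomial)] -/
theorem irreducible_polyQ : Irreducible (polyQ (-1) 3 2) :=
  haveI : Fact (Nat.Prime 7) := ⟨by norm_num⟩
  irreducible_polyQ_of_no_root 7 no_root_seven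

/-- `f mod p` written out: `f̄ = X³ − X² + 3X + 2 ∈ 𝔽_p[X]`. [cite: Marcus2018, Ch. 3, Thm. 27] -/
theorem polyMod_eq (p : ℕ) : polyMod (-1) 3 2 p = X ^ 3 - X ^ 2 + 3 * X + 2 := by
  simp [polyMod, poly]; ring

/-- `f ≡ X·(X² + X + 1) (mod 2)`. [cite: Marcus2018, Ch. 3, Thm. 27] -/
theorem polyMod_two : polyMod (-1) 3 2 2 = X * (X ^ 2 + X + 1) := by
  rw [polyMod_eq]
  have h2 : (2 : (ZMod 2)[X]) = 0 := by
    rw [show (2 : (ZMod 2)[X]) = C 2 from (map_natCast C 2).symm, show (2 : ZMod 2) = 0 from rfl, C_0]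
  linear_combination (-X ^ 2 + X + 1) * h2

/-- `f ≡ (X + 1)·(X² + X + 2) (mod 3)`. [cite: Marcus2018, Ch. 3, Thm. 27] -/
theorem polyMod_three : polyMod (-1) 3 2 3 = (X + 1) * (X ^ 2 + X + 2) := by
  rw [polyMod_eq]
  have h3 : (3 : (ZMod 3)[X]) = 0 := by
    rw [show (3 : (ZMod 3)[X]) = C 3 from (map_natCast C 3).symm, show (3 : ZMod 3) = 0 from rfl, C_0]
  linear_combination (-X ^ 2) * h3

/-- `X² + X + 1` is irreducible in `𝔽₂[X]` (no root). [cite: Marcus2018, Ch. 3, Thm. 27] -/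
theorem irreducible_quad_two : Irreducible (X ^ 2 + X + 1 : (ZMod 2)[X]) := by
  have hdeg : (X ^ 2 + X + 1 : (ZMod 2)[X]).natDegree = 2 := by compute_degree!
  refine irreducible_of_degree_le_three_of_not_isRoot (by rw [hdeg]; decide) fun x hx => ?_
  rw [IsRoot.def] at hx
  simp only [eval_add, eval_pow, eval_X, eval_one] at hx
  revert x hx
  decide

/-- `X² + X + 2` is irreducible in `𝔽₃[X]` (no root). [cite: Marcus2018, Ch. 3, Thm. 27] -/
theorem irreducible_quad_three : Irreducible (X ^ 2 + X + 2 : (ZMod 3)[X]) := by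
  have hdeg : (X ^ 2 + X + 2 : (ZMod 3)[X]).natDegree = 2 := by compute_degree!
  refine irreducible_of_degree_le_three_of_not_isRoot (by rw [hdeg]; decide) fun x hx => ?_
  rw [IsRoot.def] at hx
  simp only [eval_add, eval_pow, eval_X, eval_ofNat] at hx
  revert x hx
  decide

/-! ## §2 The field `F`: `d_F = −307`, `𝓞_F = ℤ[θ]`, signature `(1, 1)` -/

section NumberField

variable {F : Type*} [Field F] [NumberField F] {α : F}

/-- **`d_F = −307`** for a cubic number field `F ∋ α` with `α³ − α² + 3α + 2 = 0` (index criterion: `Δ(f) = −307` is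
squarefree, so `1, α, α²` is an integral basis). [cite: LMFDB, number field 3.1.307.1 (discriminant −307)]
[cite: Marcus2018, Ch. 2, Exercise 27] -/
theorem discr_eq (h3 : finrank ℚ F = 3) (hα : aeval α (poly (-1) 3 2) = 0) : discr F = -307 := by
  rw [discr_eq_disc irreducible_polyQ hα h3 isUnit_of_disc_eq_sq_mul, disc_eq]

/-- **`𝓞_F = ℤ[θ]`** (inside `𝓞_F`). [cite: LMFDB, number field 3.1.307.1 (integral basis 1, a, a²)] [cite: Marcus2018, Ch. 2, Exercise 27] -/
theorem adjoin_thetaInt_eq_top (h3 : finrank ℚ F = 3) (hα : aeval α (poly (-1) 3 2) = 0) :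
    Algebra.adjoin ℤ ({thetaInt hα} : Set (𝓞 F)) = ⊤ :=
  MonicCubic.adjoin_thetaInt_eq_top irreducible_polyQ hα h3 isUnit_of_disc_eq_sq_mul

/-- **`F` has exactly one complex place** (`r₂ = 1`): `d_F = −307 < 0` has sign `(−1)^{r₂}`, and `r₁ + 2r₂ = 3`.
[cite: LMFDB, number field 3.1.307.1 (signature [1,1])] -/
theorem nrComplexPlaces_eq_one (h3 : finrank ℚ F = 3) (hα : aeval α (poly (-1) 3 2) = 0) : nrComplexPlaces F = 1 := by
  have hsum := card_add_two_mul_card_eq_rank F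
  rw [h3] at hsum
  have hsign := NumberField.sign_discr F
  rw [discr_eq h3 hα] at hsign
  have hle : nrComplexPlaces F ≤ 1 := by omega
  rcases Nat.le_one_iff_eq_zero_or_eq_one.mp hle with h0 | h1
  · rw [h0, pow_zero, show (-307 : ℤ).sign = -1 from rfl] at hsign
    norm_num at hsign
  · exact h1

/-- **`F` has exactly one real place** (`r₁ = 1`). [cite: LMFDB, number field 3.1.307.1 (signature [1,1])] -/
theorem nrRealPlaces_eq_one (h3 : finrank ℚ F = 3) (hα : aeval α (poly (-1) 3 2) = 0) : nrRealPlaces F = 1 := by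
  have hsum := card_add_two_mul_card_eq_rank F
  rw [h3, nrComplexPlaces_eq_one h3 hα] at hsum
  omega

/-! ## §3 The primes above `2` and `3` are principal -/

/-- `θ·(θ² − θ + 3) = −2` in `𝓞_F` (from `θ³ − θ² + 3θ + 2 = 0`). [cite: LMFDB, number field 3.1.307.1 (defining polynomial)] -/
theorem theta_mul_eq (hα : aeval α (poly (-1) 3 2) = 0) :
    thetaInt hα * (thetaInt hα ^ 2 - thetaInt hα + 3) = -2 := by
  have h := thetaInt_rel hα
  push_cast at h
  linear_combination h

/-- `(θ + 1)·(θ² − 2θ + 5) = 3` in `𝓞_F` (`f = (X + 1)(X² − 2X + 5) − 3`). [cite: LMFDB, number field 3.1.307.1 (defining polynomial)] -/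
theorem theta_add_one_mul_eq (hα : aeval α (poly (-1) 3 2) = 0) :
    (thetaInt hα + 1) * (thetaInt hα ^ 2 - 2 * thetaInt hα + 5) = 3 := by
  have h := thetaInt_rel hα
  push_cast at h
  linear_combination h

/-- **`(2, θ) = (θ)`**: the residue-degree-one prime above `2` is generated by `θ` (`N(θ) = −2`; `2 = −θ(θ² − θ + 3) ∈ (θ)`).
[cite: Marcus2018, Ch. 3, Thm. 27] -/
theorem span_two_theta_eq (hα : aeval α (poly (-1) 3 2) = 0) :
    span {(2 : 𝓞 F), thetaInt hα} = span {thetaInt hα} := by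
  apply le_antisymm
  · rw [span_le]
    rintro x hx
    rcases hx with rfl | hx
    · exact mem_span_singleton'.mpr ⟨-(thetaInt hα ^ 2 - thetaInt hα + 3), by linear_combination -(theta_mul_eq hα)⟩
    · rw [Set.mem_singleton_iff.mp hx]
      exact mem_span_singleton_self _
  · rw [span_singleton_le_iff_mem]
    exact subset_span (Set.mem_insert_of_mem _ rfl)

/-- **`(2, θ² + θ + 1) = (θ² − θ + 3)`**: the residue-degree-two prime above `2` is generated by `θ² − θ + 3 = −2/θ` (norm `4`).
[cite: Marcus2018, Ch. 3, Thm. 27] -/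
theorem span_two_quad_eq (hα : aeval α (poly (-1) 3 2) = 0) :
    span {(2 : 𝓞 F), thetaInt hα ^ 2 + thetaInt hα + 1} = span {thetaInt hα ^ 2 - thetaInt hα + 3} := by
  apply le_antisymm
  · rw [span_le]
    rintro x hx
    rcases hx with rfl | hx
    · exact mem_span_singleton'.mpr ⟨-thetaInt hα, by linear_combination -(theta_mul_eq hα)⟩
    · rw [Set.mem_singleton_iff.mp hx]
      exact mem_span_singleton'.mpr ⟨-thetaInt hα ^ 2 + thetaInt hα + 1, by linear_combination (1 - thetaInt hα) * theta_mul_eq hα⟩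
  · rw [span_singleton_le_iff_mem, mem_span_pair]
    exact ⟨1 - thetaInt hα, 1, by ring⟩

/-- **`(3, θ + 1) = (θ + 1)`**: the residue-degree-one prime above `3` is generated by `θ + 1` (`N(θ + 1) = 3`;
`3 = (θ + 1)(θ² − 2θ + 5)`). [cite: Marcus2018, Ch. 3, Thm. 27] -/
theorem span_three_lin_eq (hα : aeval α (poly (-1) 3 2) = 0) :
    span {(3 : 𝓞 F), thetaInt hα + 1} = span {thetaInt hα + 1} := by
  apply le_antisymm
  · rw [span_le]
    rintro x hx
    rcases hx with rfl | hx
    · exact mem_span_singleton'.mpr ⟨thetaInt hα ^ 2 - 2 * thetaInt hα + 5, by linear_combination theta_add_one_mul_eq hα⟩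
    · rw [Set.mem_singleton_iff.mp hx]
      exact mem_span_singleton_self _
  · rw [span_singleton_le_iff_mem]
    exact subset_span (Set.mem_insert_of_mem _ rfl)

/-- **`(3, θ² + θ + 2) = (θ² − 2θ + 5)`**: the residue-degree-two prime above `3` is generated by `θ² − 2θ + 5 = 3/(θ + 1)`
(norm `9`). [cite: Marcus2018, Ch. 3, Thm. 27] -/
theorem span_three_quad_eq (hα : aeval α (poly (-1) 3 2) = 0) :
    span {(3 : 𝓞 F), thetaInt hα ^ 2 + thetaInt hα + 2} = span {thetaInt hα ^ 2 - 2 * thetaInt hα + 5} := by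
  apply le_antisymm
  · rw [span_le]
    rintro x hx
    rcases hx with rfl | hx
    · exact mem_span_singleton'.mpr ⟨thetaInt hα + 1, by linear_combination theta_add_one_mul_eq hα⟩
    · rw [Set.mem_singleton_iff.mp hx]
      exact mem_span_singleton'.mpr ⟨thetaInt hα ^ 2, by linear_combination (thetaInt hα - 1) * theta_add_one_mul_eq hα⟩
  · rw [span_singleton_le_iff_mem, mem_span_pair]
    exact ⟨1 - thetaInt hα, 1, by ring⟩

/-- **Every prime of `𝓞_F` above `2` is principal**: by Dedekind–Kummer (`𝓞_F = ℤ[θ]`, `f ≡ X(X² + X + 1) (mod 2)`) such a prime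
is `(2, θ)` or `(2, θ² + θ + 1)`, i.e. `(θ)` or `(θ² − θ + 3)`. [cite: Marcus2018, Ch. 3, Thm. 27] [cite: LMFDB, number field 3.1.307.1 (class number 1)] -/
theorem isPrincipal_of_mem_primesOver_two (h3 : finrank ℚ F = 3) (hα : aeval α (poly (-1) 3 2) = 0) {P : Ideal (𝓞 F)}
    (hP : P ∈ primesOver (span {((2 : ℕ) : ℤ)}) (𝓞 F)) : Submodule.IsPrincipal P := by
  obtain ⟨Qb, hirr, hmon, hdvd, -, hspan⟩ :=
    exists_factor_of_mem_primesOver irreducible_polyQ hα h3 isUnit_of_disc_eq_sq_mul Nat.prime_two hP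
  rw [polyMod_two] at hdvd
  rcases hirr.prime.dvd_or_dvd hdvd with h | h
  · have hQb : Qb = X := eq_of_monic_of_associated hmon monic_X (hirr.associated_of_dvd irreducible_X h)
    have hPeq := hspan X (by rw [hQb, Polynomial.map_X])
    rw [aeval_X, Nat.cast_ofNat, span_two_theta_eq hα] at hPeq
    exact ⟨⟨thetaInt hα, by rw [hPeq, Ideal.submodule_span_eq]⟩⟩
  · have hQb : Qb = X ^ 2 + X + 1 :=
      eq_of_monic_of_associated hmon (by monicity!) (hirr.associated_of_dvd irreducible_quad_two h)
    have hPeq := hspan (X ^ 2 + X + 1) (by rw [hQb]; simp)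
    rw [show aeval (thetaInt hα) (X ^ 2 + X + 1 : ℤ[X]) = thetaInt hα ^ 2 + thetaInt hα + 1 by simp, Nat.cast_ofNat,
      span_two_quad_eq hα] at hPeq
    exact ⟨⟨thetaInt hα ^ 2 - thetaInt hα + 3, by rw [hPeq, Ideal.submodule_span_eq]⟩⟩

/-- **Every prime of `𝓞_F` above `3` is principal**: by Dedekind–Kummer (`f ≡ (X + 1)(X² + X + 2) (mod 3)`) such a prime is
`(3, θ + 1) = (θ + 1)` or `(3, θ² + θ + 2) = (θ² − 2θ + 5)`. [cite: Marcus2018, Ch. 3, Thm. 27] [cite: LMFDB, number field 3.1.307.1 (class number 1)] -/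
theorem isPrincipal_of_mem_primesOver_three (h3 : finrank ℚ F = 3) (hα : aeval α (poly (-1) 3 2) = 0) {P : Ideal (𝓞 F)}
    (hP : P ∈ primesOver (span {((3 : ℕ) : ℤ)}) (𝓞 F)) : Submodule.IsPrincipal P := by
  obtain ⟨Qb, hirr, hmon, hdvd, -, hspan⟩ :=
    exists_factor_of_mem_primesOver irreducible_polyQ hα h3 isUnit_of_disc_eq_sq_mul Nat.prime_three hP
  rw [polyMod_three] at hdvd
  rcases hirr.prime.dvd_or_dvd hdvd with h | h
  · have hirr1 : Irreducible (X + 1 : (ZMod 3)[X]) := by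
      rw [show (X + 1 : (ZMod 3)[X]) = X - C (-1) by rw [map_neg, map_one, sub_neg_eq_add]]
      exact irreducible_X_sub_C _
    have hQb : Qb = X + 1 := eq_of_monic_of_associated hmon (by monicity!) (hirr.associated_of_dvd hirr1 h)
    have hPeq := hspan (X + 1) (by rw [hQb]; simp)
    rw [show aeval (thetaInt hα) (X + 1 : ℤ[X]) = thetaInt hα + 1 by simp, Nat.cast_ofNat, span_three_lin_eq hα] at hPeq
    exact ⟨⟨thetaInt hα + 1, by rw [hPeq, Ideal.submodule_span_eq]⟩⟩
  · have hQb : Qb = X ^ 2 + X + 2 :=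
      eq_of_monic_of_associated hmon (by monicity!) (hirr.associated_of_dvd irreducible_quad_three h)
    have hPeq := hspan (X ^ 2 + X + C 2) (by rw [hQb]; simp [map_ofNat])
    rw [show aeval (thetaInt hα) (X ^ 2 + X + C 2 : ℤ[X]) = thetaInt hα ^ 2 + thetaInt hα + 2 by
        simp only [map_add, map_pow, aeval_X, aeval_C, algebraMap_int_eq, Int.coe_castRingHom, Int.cast_ofNat],
      Nat.cast_ofNat, span_three_quad_eq hα] at hPeq
    exact ⟨⟨thetaInt hα ^ 2 - 2 * thetaInt hα + 5, by rw [hPeq, Ideal.submodule_span_eq]⟩⟩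

/-! ## §4 Class number one -/

/-- **`𝓞_F` is a principal ideal domain.**  Minkowski: every ideal class contains an ideal of norm
`≤ (4/π)^{r₂} (n!/nⁿ) √|d_F| = (4/π)(6/27)√307 < 5`, and the primes of norm `≤ 4` (above `2` and `3`) are principal (§3);
Mathlib's `RingOfIntegers.isPrincipalIdealRing_of_isPrincipal_of_pow_le_of_mem_primesOver_of_mem_Icc`.
[cite: LMFDB, number field 3.1.307.1 (class number 1)] [cite: Marcus2018, Ch. 5, Thm. 37 and Cor. 2] -/
theorem isPrincipalIdealRing (h3 : finrank ℚ F = 3) (hα : aeval α (poly (-1) 3 2) = 0) : IsPrincipalIdealRing (𝓞 F) := by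
  apply RingOfIntegers.isPrincipalIdealRing_of_isPrincipal_of_pow_le_of_mem_primesOver_of_mem_Icc
  rw [nrComplexPlaces_eq_one h3 hα, h3, discr_eq h3 hα]
  intro p hp hpr P hP _
  obtain ⟨hp1, hpM⟩ := Finset.mem_Icc.mp hp
  have hp4 : p ≤ 4 := by
    refine Nat.lt_succ_iff.mp (lt_of_le_of_lt hpM ((Nat.floor_lt' (by norm_num)).mpr ?_))
    have hπ := Real.pi_gt_d2
    have hπ0 := Real.pi_pos
    have hs : √(307 : ℝ) < 17.53 := by
      rw [Real.sqrt_lt' (by norm_num)]; norm_num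
    have hs0 : 0 ≤ √(307 : ℝ) := Real.sqrt_nonneg _
    have habs : |((-307 : ℤ) : ℝ)| = 307 := by norm_num
    rw [habs]
    norm_num [Nat.factorial]
    rw [div_mul_eq_mul_div, div_lt_iff₀ hπ0]
    nlinarith
  interval_cases p
  · exact absurd hpr Nat.not_prime_one
  · exact isPrincipal_of_mem_primesOver_two h3 hα hP
  · exact isPrincipal_of_mem_primesOver_three h3 hα hP
  · exact absurd hpr (by decide)

/-- ★ **`h_F = 1`: the cubic field of discriminant `−307` has class number one.** [cite: LMFDB, number field 3.1.307.1 (class number 1)] -/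
theorem classNumber_eq_one (h3 : finrank ℚ F = 3) (hα : aeval α (poly (-1) 3 2) = 0) : classNumber F = 1 :=
  (classNumber_eq_one_iff (K := F)).mpr (isPrincipalIdealRing h3 hα)

/-- **`h_F` is odd** (the form consumed by the `2`-adic doors of cell `bsd-f1-sign2`). [cite: LMFDB, number field 3.1.307.1 (class number 1)] -/
theorem not_two_dvd_classNumber (h3 : finrank ℚ F = 3) (hα : aeval α (poly (-1) 3 2) = 0) : ¬ 2 ∣ classNumber F := by
  rw [classNumber_eq_one h3 hα]; decide

end NumberField

end Literature.NumberTheory.CubicFields.CubicDisc307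

end
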